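import Literature.NumberTheory.Transcendental.FiveExponentials
import Literature.NumberTheory.Transcendental.FiveExponentialsZeroEstimate
import Literature.NumberTheory.Transcendental.FiveExponentialsAuxiliary
import Literature.NumberTheory.Transcendental.FiveExponentialsLiouville
import Literature.NumberTheory.Transcendental.LindemannWeierstrassProofs
import HarnessLib

/-!
# The five exponentials theorem, direct proof — IV: parameters and the discharge

Topic `Literature/NumberTheory/Transcendental`; sibling proof file of `FiveExponentials.lean`,
DISCHARGING the named fact `Literature.NumberTheory.Transcendental.waldschmidt1988_fiveExponentials`
([Waldschmidt1988, §2 c) Corollary 2.2]): `waldschmidt1988_fiveExponentials_holds`. Everything here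
is PROVED; there are no new definitions and no new facts. Parts I–III
(`FiveExponentialsZeroEstimate`, `…Auxiliary`, `…Liouville`) contain the zero estimate step, the
auxiliary function and the arithmetic of the derivatives; the module docstring of part I describes
the route (the proof of [Waldschmidt1988, Thm 4.1], §§6–7, run in the configuration of Cor. 2.2).

This file chooses the parameters — as in [Waldschmidt1988, Prop. 6.1] with `a = b = 1`,
`d = 3, n = 2, d₀ = 1, d₁ = 2, κ = 0`: `D₀ = C S²`, `D₁ = C S ⌈log S⌉`, `T = S²`, height
`e^{C S² log S}`, truncation order and precision `≍ S² log S` — verifies the box-principle count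
`2T₀(T₀ + D₀)V ≤ D₀D₁²H` (which fixes the constant `C` in terms of the degree and the size of
the number field `ℚ(γ, e^{γy_j}, e^{λy_j}, e^{λ})`, of `|λ/γ|` and of `|γ|, |y_j|`), the Liouville
threshold, and the six inequalities of the zero estimate (all consequences of
`16 c C³ (log S)² < S`), for `S` large (`Real.tendsto_log_atTop`,
`Real.tendsto_pow_log_div_mul_add_atTop`). It then runs the chain
part II → part III → part I to contradict the algebraicity of the five numbers
(`Waldschmidt1988.five_exp_core`), and finally performs the normalisation `γ = η`, `λ = ηx₂/x₁`,
`y_j ← x₁y_j/η` of the data of Corollary 2.2, where the two independence statements fed to part I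
(`aγ + bλ = 0 ⇒ a = b = 0` from the `ℚ`-independence of `x₁, x₂`; `ay₀ + by₁ + e = 0 ⇒ a = b = e = 0`
from the `ℚ`-independence of `y₁, y₂` and HERMITE–LINDEMANN, the tree's theorem
`transcendental_exp_holds`: `e^{-eη} = (e^{γy₀})^a (e^{γy₁})^b` would be algebraic) are established.

## References

* [Waldschmidt1988] M. Waldschmidt, *On the transcendence methods of Gel'fond and Schneider in
  several variables*, New Advances in Transcendence Theory (A. Baker ed.), CUP 1988, 375–398:
  §2 c) Corollary 2.2 (p. 378), §6 Proposition 6.1 (pp. 388–389), §7 (pp. 389–390); held scan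
  `book:baker1988-new-advances-transcendence-theory`, pp. 300, 310–312.
-/

noncomputable section

namespace Literature.NumberTheory.Transcendental

open Complex Finset GaGm DiazZL DiazZLM

namespace Waldschmidt1988

/-! ### Numerical lemmas -/

/-- **The six inequalities of the zero estimate step** (part I) for the parameters
`D₀ = CS²`, `D₁ = CSL`, `T = S²`, `B = S - 1`, all from `4cC³L² < S`. [folklore] -/
theorem six_ineqs {c C S L B : ℕ} (hC : 1 ≤ C) (hL : 1 ≤ L) (hB : B + 1 = S)
    (hkey : 4 * c * C ^ 3 * L ^ 2 < S) :
    c * (C * S ^ 2) * (2 * (C * S * L)) ^ 2 < (S ^ 2 + 1) * (B + 1) ^ 3 ∧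
    c * (C * S ^ 2) * (2 * (C * S * L)) ^ 2 < (S ^ 2 + 1) * (B + 1) ^ 2 * (2 * (C * S * L)) ∧
    c * (C * S ^ 2) * (2 * (C * S * L)) ^ 2 < (S ^ 2 + 1) * (B + 1) * (2 * (C * S * L)) ^ 2 ∧
    c * (C * S ^ 2) * (2 * (C * S * L)) ^ 2 < (S ^ 2 + 1) * (B + 1) ^ 2 * (C * S ^ 2) ∧
    c * (C * S ^ 2) * (2 * (C * S * L)) ^ 2 < (S ^ 2 + 1) * (C * S ^ 2) * (2 * (C * S * L)) ∧
    c * (C * S ^ 2) * (2 * (C * S * L)) ^ 2 < (B + 1) ^ 2 * (C * S ^ 2) * (2 * (C * S * L)) := by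
  have hSpos : 0 < S := by omega
  rw [hB]
  have hlt : c * (C * S ^ 2) * (2 * (C * S * L)) ^ 2 < S ^ 5 := by
    calc c * (C * S ^ 2) * (2 * (C * S * L)) ^ 2 = (4 * c * C ^ 3 * L ^ 2) * S ^ 4 := by ring
      _ < S * S ^ 4 := (Nat.mul_lt_mul_right (pow_pos hSpos 4)).mpr hkey
      _ = S ^ 5 := by ring
  have hCL : 1 ≤ C * L := Nat.mul_le_mul hC hL
  have h2 : S ≤ 2 * (C * S * L) := by
    calc S = 1 * S := (one_mul S).symm
      _ ≤ (2 * (C * L)) * S := Nat.mul_le_mul_right S (by omega)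
      _ = 2 * (C * S * L) := by ring
  have h3 : S ^ 2 ≤ S ^ 2 + 1 := Nat.le_succ _
  have h4 : S ^ 2 ≤ C * S ^ 2 := Nat.le_mul_of_pos_left _ hC
  refine ⟨hlt.trans_le ?_, hlt.trans_le ?_, hlt.trans_le ?_, hlt.trans_le ?_, hlt.trans_le ?_,
    hlt.trans_le ?_⟩
  · calc S ^ 5 = S ^ 2 * S ^ 3 := by ring
      _ ≤ (S ^ 2 + 1) * S ^ 3 := Nat.mul_le_mul_right _ h3
  · calc S ^ 5 = S ^ 2 * S ^ 2 * S := by ring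
      _ ≤ (S ^ 2 + 1) * S ^ 2 * (2 * (C * S * L)) := by gcongr
  · calc S ^ 5 = S ^ 2 * S * S ^ 2 := by ring
      _ ≤ (S ^ 2 + 1) * S * (2 * (C * S * L)) ^ 2 := by gcongr
  · calc S ^ 5 = S ^ 2 * S ^ 2 * S := by ring
      _ ≤ (S ^ 2 + 1) * S ^ 2 * (C * S ^ 2) := by
          gcongr
          calc S ≤ S ^ 2 := by nlinarith
            _ ≤ C * S ^ 2 := h4
  · calc S ^ 5 = S ^ 2 * S ^ 2 * S := by ring
      _ ≤ (S ^ 2 + 1) * (C * S ^ 2) * (2 * (C * S * L)) := by gcongr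
  · calc S ^ 5 = S ^ 2 * S ^ 2 * S := by ring
      _ ≤ S ^ 2 * (C * S ^ 2) * (2 * (C * S * L)) := by gcongr

/-- `log (3S²)! ≤ 9 S² log S` for `S ≥ 3`. [folklore] -/
theorem log_factorial_le {S : ℕ} (hS : 3 ≤ S) :
    Real.log ((3 * S ^ 2).factorial : ℝ) ≤ 9 * (S : ℝ) ^ 2 * Real.log S := by
  have hS0 : (0 : ℝ) < S := by exact_mod_cast (show 0 < S by omega)
  have hS3 : (3 : ℝ) ≤ S := by exact_mod_cast hS
  have hn : ((3 * S ^ 2).factorial : ℝ) ≤ ((3 * S ^ 2 : ℕ) : ℝ) ^ (3 * S ^ 2) := by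
    exact_mod_cast Nat.factorial_le_pow _
  have hpos : (0 : ℝ) < (3 * S ^ 2).factorial := by exact_mod_cast Nat.factorial_pos _
  have hlog3 : Real.log 3 ≤ Real.log S := Real.log_le_log (by norm_num) hS3
  have hlogS : 0 ≤ Real.log S := Real.log_nonneg (by linarith)
  calc Real.log ((3 * S ^ 2).factorial : ℝ) ≤ Real.log (((3 * S ^ 2 : ℕ) : ℝ) ^ (3 * S ^ 2)) :=
        Real.log_le_log hpos hn
    _ = ((3 * S ^ 2 : ℕ) : ℝ) * Real.log ((3 * S ^ 2 : ℕ) : ℝ) := by rw [Real.log_pow]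
    _ = 3 * (S : ℝ) ^ 2 * (Real.log 3 + 2 * Real.log S) := by
        push_cast
        rw [Real.log_mul (by norm_num) (by positivity), Real.log_pow]
        ring
    _ ≤ 3 * (S : ℝ) ^ 2 * (3 * Real.log S) := by
        refine mul_le_mul_of_nonneg_left ?_ (by positivity)
        linarith
    _ = 9 * (S : ℝ) ^ 2 * Real.log S := by ring

/-- **The two error terms of the auxiliary function add up to at most `e^{-U}`** when
`T₀ ≥ U + H + D₀ log R + ρ + (D₀ + 2D₁) + 3`,
`V = U + H + D₀ log R + 2ρ + 2(T₀ + D₀) + (D₀ + 2D₁) + 5`, `k ≥ e^V - 1`, `P_b ≤ e^H` (`R ≥ 1`).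
[folklore] -/
theorem final_bound2 (D₀ D₁ T₀ Pb k : ℕ) {U H ρ R V : ℝ} (hR : 1 ≤ R) (hρ : 0 ≤ ρ) (hH : 0 ≤ H)
    (hU : 0 ≤ U) (hPb : (Pb : ℝ) ≤ Real.exp H) (hk : Real.exp V ≤ k + 1)
    (hV : V = U + H + D₀ * Real.log R + 2 * ρ + 2 * (T₀ + D₀) + (D₀ + 2 * D₁) + 5)
    (hT : U + H + D₀ * Real.log R + ρ + (D₀ + 2 * D₁) + 3 ≤ T₀) :
    (T₀ * (T₀ + D₀) : ℝ) *
        (2 * ((2 * (D₀ * (D₁ * D₁) : ℝ) * (R ^ D₀ * Real.exp ρ ^ 2) * Pb + 1) / k)) +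
      (D₀ * (D₁ * D₁) : ℝ) * Pb * (R ^ D₀ * (4 * Real.exp ρ * Real.exp (-T₀))) ≤ Real.exp (-U) := by
  have hRpos : 0 < R := by linarith
  have hlogR : 0 ≤ Real.log R := Real.log_nonneg hR
  -- elementary exponential bounds
  have hN : (D₀ * (D₁ * D₁) : ℝ) ≤ Real.exp (D₀ + 2 * D₁) := by
    have h0 : (D₀ : ℝ) ≤ Real.exp D₀ := by linarith [Real.add_one_le_exp (D₀ : ℝ)]
    have h1 : (D₁ : ℝ) ≤ Real.exp D₁ := by linarith [Real.add_one_le_exp (D₁ : ℝ)]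
    calc (D₀ * (D₁ * D₁) : ℝ) ≤ Real.exp D₀ * (Real.exp D₁ * Real.exp D₁) := by
          gcongr
      _ = Real.exp (D₀ + 2 * D₁) := by rw [← Real.exp_add, ← Real.exp_add]; ring_nf
  have hRD : R ^ D₀ = Real.exp (D₀ * Real.log R) := by
    rw [Real.exp_nat_mul, Real.exp_log hRpos]
  have hTT : (T₀ * (T₀ + D₀) : ℝ) ≤ Real.exp (2 * (T₀ + D₀)) := by
    have h0 : ((T₀ : ℝ) + D₀) ≤ Real.exp (T₀ + D₀) := by linarith [Real.add_one_le_exp ((T₀ : ℝ) + D₀)]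
    have h1 : (T₀ : ℝ) ≤ (T₀ : ℝ) + D₀ := le_add_of_nonneg_right (Nat.cast_nonneg _)
    calc (T₀ * (T₀ + D₀) : ℝ) ≤ Real.exp (T₀ + D₀) * Real.exp (T₀ + D₀) :=
          mul_le_mul (h1.trans h0) h0 (by positivity) (Real.exp_pos _).le
      _ = Real.exp (2 * (T₀ + D₀)) := by rw [← Real.exp_add]; ring_nf
  have hρexp : Real.exp ρ ^ 2 = Real.exp (2 * ρ) := by rw [← Real.exp_nat_mul]; norm_num
  have hV5 : 5 ≤ V := by
    have : 0 ≤ U + H + D₀ * Real.log R + 2 * ρ + 2 * (T₀ + D₀) + (D₀ + 2 * D₁) := by positivity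
    linarith
  have hk2 : Real.exp V / 2 ≤ k := by
    have := Real.add_one_le_exp V
    linarith
  have hkpos : (0 : ℝ) < k := lt_of_lt_of_le (by positivity) hk2
  have h24 : (24 : ℝ) ≤ Real.exp 5 := by
    have h := Real.exp_one_gt_d9
    have h5 : Real.exp 5 = Real.exp 1 ^ 5 := by rw [← Real.exp_nat_mul]; norm_num
    rw [h5]
    have h' : (24 : ℝ) ≤ 2.7182818283 ^ 5 := by norm_num
    exact h'.trans (pow_le_pow_left₀ (by norm_num) h.le 5)
  have h8 : (8 : ℝ) ≤ Real.exp 3 := by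
    have h := Real.exp_one_gt_d9
    have h3 : Real.exp 3 = Real.exp 1 ^ 3 := by rw [← Real.exp_nat_mul]; norm_num
    rw [h3]
    have h' : (8 : ℝ) ≤ 2.7182818283 ^ 3 := by norm_num
    exact h'.trans (pow_le_pow_left₀ (by norm_num) h.le 3)
  -- the common factor `Y = e^{N + D₀ log R + 2ρ + H}`
  set Y : ℝ := Real.exp ((D₀ + 2 * D₁) + D₀ * Real.log R + 2 * ρ + H) with hY
  have hY1 : 1 ≤ Y := Real.one_le_exp (by positivity)
  have hXY : (D₀ * (D₁ * D₁) : ℝ) * (R ^ D₀ * Real.exp ρ ^ 2) * Pb ≤ Y := by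
    rw [hY, hRD, hρexp, Real.exp_add, Real.exp_add, Real.exp_add]
    calc (D₀ * (D₁ * D₁) : ℝ) * (Real.exp (D₀ * Real.log R) * Real.exp (2 * ρ)) * Pb
        ≤ Real.exp (D₀ + 2 * D₁) * (Real.exp (D₀ * Real.log R) * Real.exp (2 * ρ)) * Real.exp H := by
          gcongr
      _ = _ := by ring
  -- first term
  have h1 : (T₀ * (T₀ + D₀) : ℝ) *
      (2 * ((2 * (D₀ * (D₁ * D₁) : ℝ) * (R ^ D₀ * Real.exp ρ ^ 2) * Pb + 1) / k)) ≤
      Real.exp (-U) / 2 := by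
    have hX : 2 * (D₀ * (D₁ * D₁) : ℝ) * (R ^ D₀ * Real.exp ρ ^ 2) * Pb + 1 ≤ 3 * Y := by
      have := hXY
      nlinarith
    calc (T₀ * (T₀ + D₀) : ℝ) *
          (2 * ((2 * (D₀ * (D₁ * D₁) : ℝ) * (R ^ D₀ * Real.exp ρ ^ 2) * Pb + 1) / k))
        ≤ Real.exp (2 * (T₀ + D₀)) * (2 * ((3 * Y) / (Real.exp V / 2))) := by
          gcongr
      _ = 12 * (Real.exp (2 * (T₀ + D₀)) * Y / Real.exp V) := by ring
      _ = 12 * Real.exp (2 * (T₀ + D₀) + ((D₀ + 2 * D₁) + D₀ * Real.log R + 2 * ρ + H) - V) := by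
          rw [Real.exp_sub, Real.exp_add, hY]
      _ = 12 * Real.exp (-5 + -U) := by
          congr 1; rw [hV]; ring_nf
      _ = 12 * Real.exp (-5) * Real.exp (-U) := by rw [Real.exp_add]; ring
      _ ≤ 1 / 2 * Real.exp (-U) := by
          gcongr
          rw [Real.exp_neg, mul_inv_le_iff₀ (Real.exp_pos 5)]
          linarith [h24]
      _ = Real.exp (-U) / 2 := by ring
  -- second term
  have h2 : (D₀ * (D₁ * D₁) : ℝ) * Pb * (R ^ D₀ * (4 * Real.exp ρ * Real.exp (-T₀))) ≤
      Real.exp (-U) / 2 := by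
    calc (D₀ * (D₁ * D₁) : ℝ) * Pb * (R ^ D₀ * (4 * Real.exp ρ * Real.exp (-T₀)))
        ≤ Real.exp (D₀ + 2 * D₁) * Real.exp H *
            (Real.exp (D₀ * Real.log R) * (4 * Real.exp ρ * Real.exp (-T₀))) := by
          rw [hRD]
          gcongr
      _ = 4 * Real.exp ((D₀ + 2 * D₁) + H + D₀ * Real.log R + ρ - T₀) := by
          simp only [Real.exp_add, Real.exp_sub, Real.exp_neg]
          field_simp
      _ ≤ 4 * Real.exp (-3 + -U) := by
          gcongr
          linarith
      _ = 4 * Real.exp (-3) * Real.exp (-U) := by rw [Real.exp_add]; ring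
      _ ≤ 1 / 2 * Real.exp (-U) := by
          gcongr
          rw [Real.exp_neg, mul_inv_le_iff₀ (Real.exp_pos 3)]
          linarith [h8]
      _ = Real.exp (-U) / 2 := by ring
  have := Real.exp_pos (-U)
  linarith

/-! ### The parameters -/

set_option maxHeartbeats 4000000 in
/-- **Choice of the parameters** (those of [Waldschmidt1988, Prop. 6.1] with `a = b = 1`):
given Philippon's constant `c`, the degree `h`, the logarithms `L_d, L_M ≥ 0` of the denominator
and of the conjugate bound of the number field, `|κ|` and the radius constant `c_R ≥ 1`, there are
`S ≥ 3`, `C, L ≥ 1` and `T₀, P_b, k, R, ρ, U` such that, with `B + 1 = S`, `T = S²`,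
`D₀ = CS²`, `D₁ = CSL`: `4cC³L² < S` (the six inequalities of part I), the hypotheses of the box
principle of part II hold, its two error terms add up to `≤ e^{-U}`, and `U` is exactly the
Liouville exponent `log (3T)! + h·(e(L_d + L_M) + log L) + 1` of part III. [folklore] -/
theorem exists_params (c : ℕ) (hh Ld LM nκ cR : ℝ) (hh1 : 1 ≤ hh) (hLd0 : 0 ≤ Ld)
    (hLM0 : 0 ≤ LM) (hnκ0 : 0 ≤ nκ) (hcR1 : 1 ≤ cR) :
    ∃ (S B T C L D₀ D₁ T₀ Pb k : ℕ) (R ρ U : ℝ),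
      B + 1 = S ∧ T = S ^ 2 ∧ D₀ = C * S ^ 2 ∧ D₁ = C * S * L ∧ 3 ≤ S ∧ 1 ≤ C ∧ 1 ≤ L ∧
      1 ≤ D₀ ∧ 1 ≤ D₁ ∧ 1 ≤ Pb ∧ 4 * c * C ^ 3 * L ^ 2 < S ∧ R = cR * S ∧ 1 ≤ R ∧
      ρ = ((D₁ : ℝ) + D₁ * nκ) * R ∧ 8 * ρ ≤ T₀ ∧ 1 ≤ T₀ ∧ 0 < k ∧
      k ^ (2 * (T₀ * (T₀ + D₀))) < (Pb + 1) ^ (D₀ * (D₁ * D₁)) ∧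
      (T₀ * (T₀ + D₀) : ℝ) *
          (2 * ((2 * (D₀ * (D₁ * D₁) : ℝ) * (R ^ D₀ * Real.exp ρ ^ 2) * Pb + 1) / k)) +
        (D₀ * (D₁ * D₁) : ℝ) * Pb * (R ^ D₀ * (4 * Real.exp ρ * Real.exp (-T₀))) ≤ Real.exp (-U) ∧
      U = Real.log ((3 * T).factorial : ℝ) +
        hh * (((3 * T + D₀ + 5 * D₁ * (3 * B) : ℕ) : ℝ) * Ld +
          Real.log ((D₀ * (D₁ * D₁) : ℝ) * Pb *
            (((D₀ : ℝ) + D₁) ^ (3 * T) * ((((3 * B : ℕ) : ℝ)) + 1) ^ D₀)) +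
          ((3 * T + D₀ + 5 * D₁ * (3 * B) : ℕ) : ℝ) * LM) + 1 := by
  classical
  -- the constants
  set aρ : ℝ := 2 * (1 + nκ) * cR with haρ
  have haρ0 : 0 ≤ aρ := by positivity
  set α₁ : ℝ := hh * (34 * (Ld + LM) + 8) with hα₁
  set α₀ : ℝ := 12 * hh + 10 with hα₀
  have hα₁0 : 0 ≤ α₁ := by positivity
  have hα₀0 : 0 ≤ α₀ := by positivity
  set β : ℝ := 3 * α₁ + 18 * aρ + 3 * α₀ + 31 with hβ
  have hβ1 : 1 ≤ β := by linarith
  set C : ℕ := ⌈2 * (β + 1) ^ 3⌉₊ with hC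
  have hCβ : 2 * (β + 1) ^ 3 ≤ C := Nat.le_ceil _
  have hβ3 : (1 : ℝ) ≤ (β + 1) ^ 3 := one_le_pow₀ (by linarith)
  have hC2 : (2 : ℝ) ≤ C := by linarith
  have hC1r : (1 : ℝ) ≤ C := by linarith
  have hC1 : 1 ≤ C := by exact_mod_cast hC1r
  have hC0 : (0 : ℝ) ≤ C := by linarith
  -- `S` large
  set ℓ₀ : ℝ := max (max 2 (C : ℝ)) (max (Real.log cR) (Real.log (2 * C))) with hℓ₀
  set Kc : ℝ := 16 * c * (C : ℝ) ^ 3 + 1 with hKc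
  have hKc0 : 0 < Kc := by positivity
  have hev1 : ∀ᶠ N : ℕ in Filter.atTop, ℓ₀ ≤ Real.log N :=
    (Real.tendsto_log_atTop.comp tendsto_natCast_atTop_atTop).eventually_ge_atTop _
  have hev2 : ∀ᶠ N : ℕ in Filter.atTop, Real.log N ^ 2 / (1 * N + 0) < Kc⁻¹ := by
    have ht := (Real.tendsto_pow_log_div_mul_add_atTop 1 0 2 one_ne_zero).comp
      tendsto_natCast_atTop_atTop
    exact ht.eventually (gt_mem_nhds (inv_pos.mpr hKc0))
  obtain ⟨S, hS₁, hS₂, hS3⟩ : ∃ S : ℕ, ℓ₀ ≤ Real.log S ∧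
      Real.log S ^ 2 / (1 * S + 0) < Kc⁻¹ ∧ 3 ≤ S := by
    obtain ⟨S, hS⟩ := Filter.eventually_atTop.mp
      (hev1.and (hev2.and (Filter.eventually_ge_atTop 3)))
    exact ⟨S, (hS S le_rfl).1, (hS S le_rfl).2.1, (hS S le_rfl).2.2⟩
  -- the basic real quantities
  set Sr : ℝ := (S : ℝ) with hSr
  set ℓ : ℝ := Real.log S with hℓ
  have hS3r : (3 : ℝ) ≤ Sr := by rw [hSr]; exact_mod_cast hS3
  have hS1r : (1 : ℝ) ≤ Sr := by linarith
  have hS0r : (0 : ℝ) < Sr := by linarith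
  have hS1 : 1 ≤ S := by omega
  have hℓ2 : 2 ≤ ℓ := le_trans (le_trans (le_max_left _ _) (le_max_left _ _)) hS₁
  have hℓC : (C : ℝ) ≤ ℓ := le_trans (le_trans (le_max_right _ _) (le_max_left _ _)) hS₁
  have hℓcR : Real.log cR ≤ ℓ := le_trans (le_trans (le_max_left _ _) (le_max_right _ _)) hS₁
  have hℓ2C : Real.log (2 * C) ≤ ℓ :=
    le_trans (le_trans (le_max_right _ _) (le_max_right _ _)) hS₁
  have hℓ1 : 1 ≤ ℓ := by linarith
  have hℓ0 : 0 ≤ ℓ := by linarith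
  have hlog3 : Real.log 3 ≤ ℓ := Real.log_le_log (by norm_num) hS3r
  set Λ : ℝ := Sr ^ 2 * ℓ with hΛ
  have hSr2 : 9 ≤ Sr ^ 2 := by nlinarith only [hS3r]
  have hΛ18 : 18 ≤ Λ := by
    rw [hΛ]; nlinarith only [hSr2, hℓ2]
  have hΛ1 : 1 ≤ Λ := by linarith only [hΛ18]
  have hΛ0 : 0 ≤ Λ := by linarith only [hΛ18]
  have hS2Λ : Sr ^ 2 ≤ Λ := by
    rw [hΛ]; exact le_mul_of_one_le_right (sq_nonneg _) hℓ1
  have hkey_r : 16 * c * (C : ℝ) ^ 3 * ℓ ^ 2 < Sr := by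
    have h1 : ℓ ^ 2 / Sr < Kc⁻¹ := by simpa [hℓ, hSr] using hS₂
    rw [div_lt_iff₀ hS0r] at h1
    have h2 : Kc * ℓ ^ 2 < Sr := by
      have := mul_lt_mul_of_pos_left h1 hKc0
      rwa [← mul_assoc, mul_inv_cancel₀ hKc0.ne', one_mul] at this
    rw [hKc] at h2
    nlinarith only [h2, sq_nonneg ℓ]
  -- the integer parameters
  set L : ℕ := ⌈ℓ⌉₊ with hL
  have hℓL : ℓ ≤ L := Nat.le_ceil _
  have hL1 : 1 ≤ L := by
    have : (1 : ℝ) ≤ L := hℓ1.trans hℓL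
    exact_mod_cast this
  have hL0 : (0 : ℝ) < L := by exact_mod_cast (show 0 < L by omega)
  have hL2ℓ : (L : ℝ) ≤ 2 * ℓ := by
    have := Nat.ceil_lt_add_one hℓ0
    rw [← hL] at this
    linarith
  set B : ℕ := S - 1 with hB
  have hB1 : B + 1 = S := Nat.sub_add_cancel hS1
  have hBr : (B : ℝ) + 1 = Sr := by rw [hSr]; exact_mod_cast hB1
  set T : ℕ := S ^ 2 with hT
  set D₀ : ℕ := C * S ^ 2 with hD₀
  set D₁ : ℕ := C * S * L with hD₁
  have hD₀r : (D₀ : ℝ) = C * Sr ^ 2 := by rw [hD₀, hSr]; push_cast; ring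
  have hD₁r : (D₁ : ℝ) = C * Sr * L := by rw [hD₁, hSr]; push_cast; ring
  have hTr : (T : ℝ) = Sr ^ 2 := by rw [hT, hSr]; push_cast; ring
  have hD₀1 : 1 ≤ D₀ := by
    rw [hD₀]; exact Nat.mul_le_mul hC1 (Nat.one_le_pow _ _ (by omega))
  have hD₁1 : 1 ≤ D₁ := by
    rw [hD₁]; exact Nat.mul_le_mul (Nat.mul_le_mul hC1 hS1) hL1
  have hD₀pos : (0 : ℝ) < D₀ := by exact_mod_cast hD₀1
  have hD₁pos : (0 : ℝ) < D₁ := by exact_mod_cast hD₁1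
  have hD₀Λ : (D₀ : ℝ) ≤ C * Λ := by rw [hD₀r]; exact mul_le_mul_of_nonneg_left hS2Λ hC0
  have hD₁ℓ : (D₁ : ℝ) ≤ C * Sr * (2 * ℓ) := by
    rw [hD₁r]; exact mul_le_mul_of_nonneg_left hL2ℓ (by positivity)
  have hSrsq : Sr ≤ Sr ^ 2 := by nlinarith only [hS1r]
  have hD₁Λ : (D₁ : ℝ) ≤ 2 * C * Λ := by
    refine hD₁ℓ.trans ?_
    rw [hΛ]
    nlinarith only [hSrsq, mul_nonneg hC0 hℓ0]
  have hD₀D₁ : (D₀ : ℝ) + 2 * D₁ ≤ 5 * C * Λ := by linarith only [hD₀Λ, hD₁Λ]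
  have hkey : 4 * c * C ^ 3 * L ^ 2 < S := by
    have : (4 * c * C ^ 3 * L ^ 2 : ℝ) < S := by
      calc (4 * c * C ^ 3 * L ^ 2 : ℝ) ≤ 4 * c * C ^ 3 * (2 * ℓ) ^ 2 := by gcongr
        _ = 16 * c * (C : ℝ) ^ 3 * ℓ ^ 2 := by ring
        _ < Sr := hkey_r
    exact_mod_cast this
  -- the height and the radius
  set H : ℝ := C * Λ with hHdef
  have hH0 : 0 ≤ H := by positivity
  set Pb : ℕ := ⌊Real.exp H⌋₊ with hPb
  have hPble : (Pb : ℝ) ≤ Real.exp H := Nat.floor_le (Real.exp_pos _).le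
  have hPblt : Real.exp H < Pb + 1 := Nat.lt_floor_add_one _
  have hPb1 : 1 ≤ Pb := Nat.succ_le_of_lt (Nat.floor_pos.mpr (Real.one_le_exp hH0))
  have hPbpos : (0 : ℝ) < Pb := by exact_mod_cast hPb1
  set R : ℝ := cR * Sr with hRdef
  have hR1 : 1 ≤ R := by rw [hRdef]; exact one_le_mul_of_one_le_of_one_le hcR1 hS1r
  have hR0 : 0 < R := by linarith only [hR1]
  have hlogR : Real.log R ≤ 2 * ℓ := by
    rw [hRdef, Real.log_mul (by linarith only [hcR1]) hS0r.ne']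
    have : Real.log Sr = ℓ := by rw [hℓ, hSr]
    linarith only [this, hℓcR]
  have hlogR0 : 0 ≤ Real.log R := Real.log_nonneg hR1
  have hD₀logR : (D₀ : ℝ) * Real.log R ≤ 2 * C * Λ := by
    rw [hD₀r, hΛ]
    calc (C : ℝ) * Sr ^ 2 * Real.log R ≤ C * Sr ^ 2 * (2 * ℓ) := by gcongr
      _ = 2 * C * (Sr ^ 2 * ℓ) := by ring
  set ρ : ℝ := ((D₁ : ℝ) + D₁ * nκ) * R with hρdef
  have hρ0 : 0 ≤ ρ := by positivity
  have hρΛ : ρ ≤ aρ * C * Λ := by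
    rw [hρdef, haρ, hRdef]
    calc ((D₁ : ℝ) + D₁ * nκ) * (cR * Sr) = D₁ * Sr * ((1 + nκ) * cR) := by ring
      _ ≤ (C * Sr * (2 * ℓ)) * Sr * ((1 + nκ) * cR) := by gcongr
      _ = 2 * (1 + nκ) * cR * C * (Sr ^ 2 * ℓ) := by ring
  -- the Liouville exponent `U`
  set ee : ℕ := 3 * T + D₀ + 5 * D₁ * (3 * B) with hee
  have heeΛ : (ee : ℝ) ≤ 34 * C * Λ := by
    rw [hee]
    push_cast
    rw [hTr]
    have hBr' : (B : ℝ) ≤ Sr := by linarith only [hBr]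
    have h1 : (5 : ℝ) * D₁ * (3 * B) ≤ 30 * C * Λ := by
      calc (5 : ℝ) * D₁ * (3 * B) ≤ 5 * (C * Sr * (2 * ℓ)) * (3 * Sr) := by gcongr
        _ = 30 * C * (Sr ^ 2 * ℓ) := by ring
    have h2 : (3 : ℝ) * Sr ^ 2 ≤ 3 * C * Λ := by
      have : Sr ^ 2 ≤ C * Λ := le_trans hS2Λ (le_mul_of_one_le_left hΛ0 hC1r)
      linarith only [this]
    have h3 : Λ = Sr ^ 2 * ℓ := hΛ
    linarith only [h1, h2, h3, hD₀Λ]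
  set Lr : ℝ := (D₀ * (D₁ * D₁) : ℝ) * Pb *
    (((D₀ : ℝ) + D₁) ^ (3 * T) * ((((3 * B : ℕ) : ℝ)) + 1) ^ D₀) with hLrdef
  have hLrpos : 0 < Lr := by positivity
  have hlogLr : Real.log Lr ≤ (8 * C + 12) * Λ := by
    have hN : (D₀ * (D₁ * D₁) : ℝ) ≤ Real.exp (D₀ + 2 * D₁) := by
      have h0 : (D₀ : ℝ) ≤ Real.exp D₀ := by linarith only [Real.add_one_le_exp (D₀ : ℝ)]
      have h1 : (D₁ : ℝ) ≤ Real.exp D₁ := by linarith only [Real.add_one_le_exp (D₁ : ℝ)]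
      calc (D₀ * (D₁ * D₁) : ℝ) ≤ Real.exp D₀ * (Real.exp D₁ * Real.exp D₁) := by gcongr
        _ = Real.exp (D₀ + 2 * D₁) := by
            rw [← Real.exp_add, ← Real.exp_add]; congr 1; ring
    have hA : Real.log (D₀ * (D₁ * D₁) : ℝ) ≤ 5 * C * Λ := by
      calc Real.log (D₀ * (D₁ * D₁) : ℝ) ≤ Real.log (Real.exp (D₀ + 2 * D₁)) :=
            Real.log_le_log (by positivity) hN
        _ = D₀ + 2 * D₁ := Real.log_exp _
        _ ≤ 5 * C * Λ := hD₀D₁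
    have hBlog : Real.log Pb ≤ H := by
      calc Real.log Pb ≤ Real.log (Real.exp H) := Real.log_le_log hPbpos hPble
        _ = H := Real.log_exp _
    have hL1r : (1 : ℝ) ≤ L := by exact_mod_cast hL1
    have hD01 : (D₀ : ℝ) + D₁ ≤ 2 * C * Sr ^ 2 * L := by
      rw [hD₀r, hD₁r]
      have a1 : (C : ℝ) * Sr ^ 2 ≤ C * Sr ^ 2 * L := le_mul_of_one_le_right (by positivity) hL1r
      have hCL : 0 ≤ (C : ℝ) * L := by positivity
      have a2 : (C : ℝ) * Sr * L ≤ C * Sr ^ 2 * L := by nlinarith only [hSrsq, hCL]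
      linarith only [a1, a2]
    have hLlog : Real.log L ≤ ℓ := by
      calc Real.log L ≤ (L : ℝ) - 1 := Real.log_le_sub_one_of_pos hL0
        _ ≤ ℓ := by linarith only [Nat.ceil_lt_add_one hℓ0, hL]
    have hClog : Real.log ((D₀ : ℝ) + D₁) ≤ 4 * ℓ := by
      have hlSr : Real.log Sr = ℓ := by rw [hℓ, hSr]
      calc Real.log ((D₀ : ℝ) + D₁) ≤ Real.log (2 * C * Sr ^ 2 * L) :=
            Real.log_le_log (by positivity) hD01
        _ = Real.log (2 * C) + 2 * Real.log Sr + Real.log L := by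
            rw [Real.log_mul (by positivity) (by positivity),
              Real.log_mul (by positivity) (by positivity), Real.log_pow]
            push_cast
            ring
        _ ≤ ℓ + 2 * ℓ + ℓ := by
            rw [hlSr]
            linarith only [hℓ2C, hLlog]
        _ = 4 * ℓ := by ring
    have hC3 : (3 * T : ℝ) * Real.log ((D₀ : ℝ) + D₁) ≤ 12 * Λ := by
      rw [hTr, hΛ]
      calc (3 : ℝ) * Sr ^ 2 * Real.log ((D₀ : ℝ) + D₁) ≤ 3 * Sr ^ 2 * (4 * ℓ) := by gcongr
        _ = 12 * (Sr ^ 2 * ℓ) := by ring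
    have hB3 : (((3 * B : ℕ) : ℝ)) + 1 ≤ 3 * Sr := by push_cast; linarith only [hBr]
    have hDlog : (D₀ : ℝ) * Real.log ((((3 * B : ℕ) : ℝ)) + 1) ≤ 2 * C * Λ := by
      have h1 : Real.log ((((3 * B : ℕ) : ℝ)) + 1) ≤ 2 * ℓ := by
        calc Real.log ((((3 * B : ℕ) : ℝ)) + 1) ≤ Real.log (3 * Sr) :=
              Real.log_le_log (by positivity) hB3
          _ = Real.log 3 + ℓ := by rw [Real.log_mul (by norm_num) hS0r.ne', hℓ, hSr]
          _ ≤ 2 * ℓ := by linarith only [hlog3]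
      calc (D₀ : ℝ) * Real.log ((((3 * B : ℕ) : ℝ)) + 1) ≤ (C * Sr ^ 2) * (2 * ℓ) := by
            rw [hD₀r]
            exact mul_le_mul_of_nonneg_left h1 (by positivity)
        _ = 2 * C * Λ := by rw [hΛ]; ring
    have e1 : ((D₀ : ℝ) + D₁) ^ (3 * T) = Real.exp (((3 * T : ℕ) : ℝ) * Real.log ((D₀ : ℝ) + D₁)) := by
      rw [Real.exp_nat_mul, Real.exp_log (by positivity)]
    have e2 : ((((3 * B : ℕ) : ℝ)) + 1) ^ D₀ =
        Real.exp (((D₀ : ℕ) : ℝ) * Real.log ((((3 * B : ℕ) : ℝ)) + 1)) := by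
      rw [Real.exp_nat_mul, Real.exp_log (by positivity)]
    have hLrle : Lr ≤ Real.exp ((8 * C + 12) * Λ) := by
      rw [hLrdef, e1, e2]
      have p1 : (D₀ * (D₁ * D₁) : ℝ) ≤ Real.exp (5 * C * Λ) :=
        hN.trans (Real.exp_le_exp.mpr hD₀D₁)
      have p3 : Real.exp (((3 * T : ℕ) : ℝ) * Real.log ((D₀ : ℝ) + D₁)) ≤ Real.exp (12 * Λ) := by
        apply Real.exp_le_exp.mpr
        push_cast
        exact hC3
      have p4 : Real.exp (((D₀ : ℕ) : ℝ) * Real.log ((((3 * B : ℕ) : ℝ)) + 1)) ≤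
          Real.exp (2 * C * Λ) := Real.exp_le_exp.mpr hDlog
      calc (D₀ * (D₁ * D₁) : ℝ) * Pb *
            (Real.exp (((3 * T : ℕ) : ℝ) * Real.log ((D₀ : ℝ) + D₁)) *
              Real.exp (((D₀ : ℕ) : ℝ) * Real.log ((((3 * B : ℕ) : ℝ)) + 1)))
          ≤ Real.exp (5 * C * Λ) * Real.exp H * (Real.exp (12 * Λ) * Real.exp (2 * C * Λ)) := by
            gcongr
        _ = Real.exp ((8 * C + 12) * Λ) := by
            rw [← Real.exp_add, ← Real.exp_add, ← Real.exp_add]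
            congr 1
            rw [hHdef]
            ring
    calc Real.log Lr ≤ Real.log (Real.exp ((8 * C + 12) * Λ)) := Real.log_le_log hLrpos hLrle
      _ = (8 * C + 12) * Λ := Real.log_exp _
  set U : ℝ := Real.log ((3 * T).factorial : ℝ) + hh * (ee * Ld + Real.log Lr + ee * LM) + 1
    with hUdef
  have hlogfac : Real.log ((3 * T).factorial : ℝ) ≤ 9 * Λ := by
    rw [hT, hΛ, hSr, hℓ]
    have := log_factorial_le hS3
    linarith only [this]
  have hlogfac0 : 0 ≤ Real.log ((3 * T).factorial : ℝ) :=
    Real.log_nonneg (by exact_mod_cast Nat.succ_le_of_lt (Nat.factorial_pos _))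
  have hlogLr0 : 0 ≤ Real.log Lr := by
    refine Real.log_nonneg ?_
    rw [hLrdef]
    have a : (1 : ℝ) ≤ D₀ := by exact_mod_cast hD₀1
    have b : (1 : ℝ) ≤ D₁ := by exact_mod_cast hD₁1
    have h1 : (1 : ℝ) ≤ (D₀ * (D₁ * D₁) : ℝ) :=
      one_le_mul_of_one_le_of_one_le a (one_le_mul_of_one_le_of_one_le b b)
    have h2 : (1 : ℝ) ≤ Pb := by exact_mod_cast hPb1
    have h3 : (1 : ℝ) ≤ ((D₀ : ℝ) + D₁) ^ (3 * T) :=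
      one_le_pow₀ (by linarith only [a, hD₁pos])
    have h4 : (1 : ℝ) ≤ ((((3 * B : ℕ) : ℝ)) + 1) ^ D₀ :=
      one_le_pow₀ (le_add_of_nonneg_left (Nat.cast_nonneg _))
    exact one_le_mul_of_one_le_of_one_le (one_le_mul_of_one_le_of_one_le h1 h2)
      (one_le_mul_of_one_le_of_one_le h3 h4)
  have hin0 : 0 ≤ ee * Ld + Real.log Lr + ee * LM :=
    add_nonneg (add_nonneg (mul_nonneg (Nat.cast_nonneg _) hLd0) hlogLr0)
      (mul_nonneg (Nat.cast_nonneg _) hLM0)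
  have hU0 : 0 ≤ U := by
    have : 0 ≤ hh * (ee * Ld + Real.log Lr + ee * LM) := mul_nonneg (by linarith only [hh1]) hin0
    linarith only [this, hlogfac0, hUdef]
  have hUΛ : U ≤ (α₁ * C + α₀) * Λ := by
    have hin : ee * Ld + Real.log Lr + ee * LM ≤ ((34 * (Ld + LM) + 8) * C + 12) * Λ := by
      have a : (ee : ℝ) * Ld ≤ 34 * C * Λ * Ld := mul_le_mul_of_nonneg_right heeΛ hLd0
      have b : (ee : ℝ) * LM ≤ 34 * C * Λ * LM := mul_le_mul_of_nonneg_right heeΛ hLM0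
      have e1 : 34 * (C : ℝ) * Λ * Ld + (8 * C + 12) * Λ + 34 * C * Λ * LM =
          ((34 * (Ld + LM) + 8) * C + 12) * Λ := by ring
      linarith only [hlogLr, a, b, e1]
    have h1 : hh * (ee * Ld + Real.log Lr + ee * LM) ≤ hh * (((34 * (Ld + LM) + 8) * C + 12) * Λ) :=
      mul_le_mul_of_nonneg_left hin (by linarith only [hh1])
    have e2 : (α₁ * C + α₀) * Λ = 9 * Λ + hh * (((34 * (Ld + LM) + 8) * C + 12) * Λ) +
        (12 * hh * Λ - 12 * hh * Λ) + Λ := by rw [hα₁, hα₀]; ring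
    rw [e2]
    linarith only [hlogfac, hΛ1, h1, hUdef]
  -- the truncation order, the precision, the box constant
  set T₀ : ℕ := ⌈8 * ρ + U + H + D₀ * Real.log R + (D₀ + 2 * D₁) + 3⌉₊ with hT₀def
  have hD₀lR0 : 0 ≤ (D₀ : ℝ) * Real.log R := mul_nonneg (Nat.cast_nonneg _) hlogR0
  have hD₀D₁0 : 0 ≤ (D₀ : ℝ) + 2 * D₁ := by positivity
  have hbase0 : 0 ≤ 8 * ρ + U + H + D₀ * Real.log R + (D₀ + 2 * D₁) := by
    linarith only [hρ0, hU0, hH0, hD₀lR0, hD₀D₁0]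
  have hT₀ge : 8 * ρ + U + H + D₀ * Real.log R + (D₀ + 2 * D₁) + 3 ≤ T₀ := Nat.le_ceil _
  have hT₀lt : (T₀ : ℝ) < 8 * ρ + U + H + D₀ * Real.log R + (D₀ + 2 * D₁) + 3 + 1 :=
    Nat.ceil_lt_add_one (by linarith only [hbase0])
  have hT₀8 : 8 * ρ ≤ T₀ := by linarith only [hT₀ge, hU0, hH0, hD₀lR0, hD₀D₁0]
  have hT₀1 : 1 ≤ T₀ := by
    have : (1 : ℝ) ≤ T₀ := by linarith only [hT₀ge, hbase0]
    exact_mod_cast this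
  set AT : ℝ := α₁ * C + α₀ + (8 * aρ + 8) * C + 2 with hAT
  have hT₀Λ : (T₀ : ℝ) ≤ AT * Λ := by
    have h1 : (T₀ : ℝ) ≤ 8 * (aρ * C * Λ) + (α₁ * C + α₀) * Λ + C * Λ + 2 * C * Λ +
        5 * C * Λ + 4 := by
      linarith only [hT₀lt, hρΛ, hUΛ, hD₀logR, hD₀D₁, hHdef]
    have e1 : AT * Λ = 8 * (aρ * C * Λ) + (α₁ * C + α₀) * Λ + C * Λ + 2 * C * Λ +
        5 * C * Λ + 2 * Λ := by rw [hAT]; ring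
    rw [e1]
    linarith only [h1, hΛ18]
  set V : ℝ := U + H + D₀ * Real.log R + 2 * ρ + 2 * (T₀ + D₀) + (D₀ + 2 * D₁) + 5 with hVdef
  have hTD0 : (0 : ℝ) ≤ T₀ + D₀ := by positivity
  have hV0 : 0 ≤ V := by linarith only [hVdef, hU0, hH0, hD₀lR0, hρ0, hTD0, hD₀D₁0]
  set AV : ℝ := α₁ * C + α₀ + (10 + 2 * aρ) * C + 2 * AT + 1 with hAV
  have hVΛ : V ≤ AV * Λ := by
    have h1 : V ≤ (α₁ * C + α₀) * Λ + C * Λ + 2 * C * Λ + 2 * (aρ * C * Λ) +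
        2 * (AT * Λ + C * Λ) + 5 * C * Λ + 5 := by
      linarith only [hVdef, hUΛ, hD₀logR, hρΛ, hT₀Λ, hD₀Λ, hD₀D₁, hHdef]
    have e1 : AV * Λ = (α₁ * C + α₀) * Λ + C * Λ + 2 * C * Λ + 2 * (aρ * C * Λ) +
        2 * (AT * Λ + C * Λ) + 5 * C * Λ + Λ := by rw [hAV]; ring
    rw [e1]
    linarith only [h1, hΛ18]
  set k : ℕ := ⌊Real.exp V⌋₊ with hkdef
  have hkle : (k : ℝ) ≤ Real.exp V := Nat.floor_le (Real.exp_pos _).le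
  have hklt : Real.exp V < k + 1 := Nat.lt_floor_add_one _
  have hkpos : 0 < k := Nat.floor_pos.mpr (Real.one_le_exp hV0)
  -- the count `2 T₀ (T₀ + D₀) V ≤ D₀ D₁² H`
  have hα₀C : α₀ ≤ α₀ * C := le_mul_of_one_le_right hα₀0 hC1r
  have hα₁C : 0 ≤ α₁ * C := mul_nonneg hα₁0 hC0
  have haρC : 0 ≤ aρ * C := mul_nonneg haρ0 hC0
  have hATβ : AT ≤ β * C := by
    have e1 : β * C = 3 * (α₁ * C) + 18 * (aρ * C) + 3 * (α₀ * C) + 31 * C := by rw [hβ]; ring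
    have e2 : AT = α₁ * C + α₀ + 8 * (aρ * C) + 8 * C + 2 := by rw [hAT]; ring
    rw [e1, e2]
    linarith only [hC1r, hα₀0, hα₀C, hα₁C, haρC]
  have hAVβ : AV ≤ β * C := by
    have e1 : β * C = 3 * (α₁ * C) + 18 * (aρ * C) + 3 * (α₀ * C) + 31 * C := by rw [hβ]; ring
    have e2 : AV = 3 * (α₁ * C) + 3 * α₀ + 26 * C + 18 * (aρ * C) + 5 := by rw [hAV, hAT]; ring
    rw [e1, e2]
    linarith only [hC1r, hα₀0, hα₀C, hα₁C, haρC]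
  have hAT0 : 0 ≤ AT := by rw [hAT]; positivity
  have hAV0 : 0 ≤ AV := by rw [hAV]; positivity
  have hT₀0 : (0 : ℝ) ≤ T₀ := Nat.cast_nonneg _
  have hcount : 2 * (T₀ : ℝ) * (T₀ + D₀) * V ≤ (D₀ * (D₁ * D₁) : ℝ) * H := by
    have a : (T₀ : ℝ) + D₀ ≤ (AT + C) * Λ := by linarith only [hT₀Λ, hD₀Λ]
    have h1 : 2 * (T₀ : ℝ) * (T₀ + D₀) * V ≤ 2 * (AT * Λ) * ((AT + C) * Λ) * (AV * Λ) := by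
      calc 2 * (T₀ : ℝ) * (T₀ + D₀) * V ≤ 2 * (AT * Λ) * (T₀ + D₀) * V := by gcongr
        _ ≤ 2 * (AT * Λ) * ((AT + C) * Λ) * V := by gcongr
        _ ≤ 2 * (AT * Λ) * ((AT + C) * Λ) * (AV * Λ) := by gcongr
    have h2 : 2 * AT * (AT + C) * AV ≤ (C : ℝ) ^ 4 := by
      have hβ0 : 0 ≤ β := by linarith only [hβ1]
      calc 2 * AT * (AT + C) * AV ≤ 2 * (β * C) * (β * C + C) * (β * C) := by gcongr
        _ = (2 * ((β + 1) * β ^ 2)) * (C : ℝ) ^ 3 := by ring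
        _ ≤ (2 * (β + 1) ^ 3) * (C : ℝ) ^ 3 := by
            have : (β + 1) * β ^ 2 ≤ (β + 1) ^ 3 := by nlinarith only [hβ0]
            gcongr
        _ ≤ C * (C : ℝ) ^ 3 := by gcongr
        _ = (C : ℝ) ^ 4 := by ring
    have h3 : (C : ℝ) ^ 4 * Λ ^ 3 ≤ (D₀ * (D₁ * D₁) : ℝ) * H := by
      rw [hD₀r, hD₁r, hHdef, hΛ]
      calc (C : ℝ) ^ 4 * (Sr ^ 2 * ℓ) ^ 3 = (C * Sr ^ 2) * ((C * Sr * ℓ) * (C * Sr * ℓ)) *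
            (C * (Sr ^ 2 * ℓ)) := by ring
        _ ≤ (C * Sr ^ 2) * ((C * Sr * L) * (C * Sr * L)) * (C * (Sr ^ 2 * ℓ)) := by gcongr
    calc 2 * (T₀ : ℝ) * (T₀ + D₀) * V ≤ 2 * (AT * Λ) * ((AT + C) * Λ) * (AV * Λ) := h1
      _ = (2 * AT * (AT + C) * AV) * Λ ^ 3 := by ring
      _ ≤ (C : ℝ) ^ 4 * Λ ^ 3 := by gcongr
      _ ≤ _ := h3
  have hcard : k ^ (2 * (T₀ * (T₀ + D₀))) < (Pb + 1) ^ (D₀ * (D₁ * D₁)) := by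
    have hDpos : 0 < D₀ * (D₁ * D₁) := by positivity
    have h1 : (k : ℝ) ^ (2 * (T₀ * (T₀ + D₀))) ≤ Real.exp ((D₀ * (D₁ * D₁) : ℝ) * H) := by
      calc (k : ℝ) ^ (2 * (T₀ * (T₀ + D₀))) ≤ Real.exp V ^ (2 * (T₀ * (T₀ + D₀))) :=
            pow_le_pow_left₀ (Nat.cast_nonneg _) hkle _
        _ = Real.exp (((2 * (T₀ * (T₀ + D₀)) : ℕ) : ℝ) * V) := by rw [Real.exp_nat_mul]
        _ ≤ Real.exp ((D₀ * (D₁ * D₁) : ℝ) * H) := by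
            apply Real.exp_le_exp.mpr
            push_cast
            linarith only [hcount]
    have h2 : Real.exp ((D₀ * (D₁ * D₁) : ℝ) * H) < ((Pb + 1 : ℕ) : ℝ) ^ (D₀ * (D₁ * D₁)) := by
      rw [show (D₀ * (D₁ * D₁) : ℝ) * H = ((D₀ * (D₁ * D₁) : ℕ) : ℝ) * H by push_cast; ring,
        Real.exp_nat_mul]
      push_cast
      exact pow_lt_pow_left₀ hPblt (Real.exp_pos _).le hDpos.ne'
    exact_mod_cast h1.trans_lt h2
  -- the two error terms
  have hE := final_bound2 D₀ D₁ T₀ Pb k hR1 hρ0 hH0 hU0 hPble hklt.le rfl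
    (by linarith only [hT₀ge, hρ0])
  refine ⟨S, B, T, C, L, D₀, D₁, T₀, Pb, k, R, ρ, U, hB1, rfl, rfl, rfl, hS3, hC1, hL1, hD₀1, hD₁1,
    hPb1, hkey, rfl, hR1, rfl, hT₀8, hT₀1, hkpos, hcard, hE, ?_⟩
  rw [hUdef]

/-! ### The direct proof, for normalised data -/

set_option maxHeartbeats 1600000 in
/-- **The five exponentials theorem for normalised data.** Let `γ ∈ ℚ̄`, `λ ∈ ℂ`, `y₀, y₁ ∈ ℂ` with
`aγ + bλ = 0 ⇒ a = b = 0` and `ay₀ + by₁ + e = 0 ⇒ a = b = e = 0` (integers `a, b, e`). Then the five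
numbers `e^{γy₀}, e^{γy₁}, e^{λy₀}, e^{λy₁}, e^{λ}` are not all algebraic. This is
[Waldschmidt1988, Thm 4.1] for `G = 𝔾ₐ × 𝔾ₘ²`, `V = {λu₀ + λu₁ = γu₂}`, `W = ℂ(1;-1,0)`,
`Y = ℤ(0;γy₀,λy₀) + ℤ(0;γy₁,λy₁) + ℤ(γ;0,λ)`, proved along §§6–7 with the parameters of
Proposition 6.1 (`a = b = 1`): parts II (auxiliary function), III (Liouville) and I (zero
estimate). [cite: Waldschmidt1988, §4 Theorem 4.1, §6 Proposition 6.1, §7] -/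
theorem five_exp_core (γ lam : ℂ) (y : Fin 2 → ℂ) (hγalg : IsAlgebraic ℚ γ)
    (hγl : ∀ a b : ℤ, (a : ℂ) * γ + b * lam = 0 → a = 0 ∧ b = 0)
    (hy1 : ∀ a b e : ℤ, (a : ℂ) * y 0 + b * y 1 + e = 0 → a = 0 ∧ b = 0 ∧ e = 0)
    (hβ : ∀ j, IsAlgebraic ℚ (cexp (γ * y j))) (hα : ∀ j, IsAlgebraic ℚ (cexp (lam * y j)))
    (hαl : IsAlgebraic ℚ (cexp lam)) : False := by
  classical
  have hγ0 : γ ≠ 0 := fun h => by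
    have := (hγl 1 0 (by rw [h]; simp)).1
    exact one_ne_zero this
  obtain ⟨c, hc⟩ := zeroEstimate_fiveExp
  -- the number field `K = ℚ(γ, e^{γy_j}, e^{λy_j}, e^{λ})`
  obtain ⟨G, i₀, i₁, i₂, i₃, i₄, i₅, hG0, hG1, hG2, hG3, hG4, hG5⟩ :
      ∃ (G : AlgGens) (i₀ i₁ i₂ i₃ i₄ i₅ : G.ι), G.a i₀ = γ ∧ G.a i₁ = cexp (γ * y 0) ∧
        G.a i₂ = cexp (γ * y 1) ∧ G.a i₃ = cexp (lam * y 0) ∧ G.a i₄ = cexp (lam * y 1) ∧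
        G.a i₅ = cexp lam :=
    ⟨{ ι := Fin 6
       a := ![γ, cexp (γ * y 0), cexp (γ * y 1), cexp (lam * y 0), cexp (lam * y 1), cexp lam]
       alg := by
         intro i
         fin_cases i
         · exact hγalg
         · exact hβ 0
         · exact hβ 1
         · exact hα 0
         · exact hα 1
         · exact hαl },
      0, 1, 2, 3, 4, 5, rfl, rfl, rfl, rfl, rfl, rfl⟩
  -- the constants of the data and the parameters
  have hh1 : (1 : ℝ) ≤ (G.h : ℝ) := by exact_mod_cast G.one_le_h
  have hLd0 : 0 ≤ Real.log |(G.den : ℝ)| := Real.log_nonneg G.one_le_abs_den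
  have hLM0 : 0 ≤ Real.log G.M := Real.log_nonneg G.one_le_M
  set cR : ℝ := 3 * ‖γ‖ * (‖y 0‖ + ‖y 1‖ + 1) + 1 with hcR
  have hcR1 : 1 ≤ cR := by
    have : 0 ≤ 3 * ‖γ‖ * (‖y 0‖ + ‖y 1‖ + 1) := by positivity
    linarith
  obtain ⟨S, B, T, C, L, D₀, D₁, T₀, Pb, k, R, ρ, U, hB1, hT, hD₀, hD₁, hS3, hC1, hL1, hD₀1, hD₁1,
    hPb1, hkey, hRdef, hR1, hρdef, hT₀8, hT₀1, hkpos, hcard, hE, hUdef⟩ :=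
    exists_params c (G.h : ℝ) (Real.log |(G.den : ℝ)|) (Real.log G.M) ‖lam / γ‖ cR hh1 hLd0 hLM0
      (norm_nonneg _) hcR1
  -- part I's six inequalities
  obtain ⟨i1, i2, i3, i4, i5, i6⟩ := six_ineqs (c := c) hC1 hL1 hB1 hkey
  rw [← hD₀, ← hD₁] at i1 i2 i3 i4 i5 i6
  rw [← hT] at i1 i2 i3 i4 i5
  -- part II: the auxiliary function
  have hρ₁ : (D₁ : ℝ) * R ≤ ρ := by
    rw [hρdef]
    have h1 : (0 : ℝ) ≤ D₁ * ‖lam / γ‖ * R := by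
      have : (0 : ℝ) ≤ R := by linarith
      positivity
    nlinarith
  have hρ₂ : ((D₁ : ℝ) + D₁ * ‖lam / γ‖) * R ≤ ρ := by rw [hρdef]
  obtain ⟨p, hp0, hpP, hF⟩ := exists_smallValues (lam / γ) hR1 Pb k hT₀8 hT₀1 hρ₁ hρ₂ hkpos hcard
  -- the Liouville threshold
  set ee : ℕ := 3 * T + D₀ + 5 * D₁ * (3 * B) with hee
  set Lr : ℝ := (D₀ * (D₁ * D₁) : ℝ) * Pb *
    (((D₀ : ℝ) + D₁) ^ (3 * T) * ((((3 * B : ℕ) : ℝ)) + 1) ^ D₀) with hLrdef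
  have hD₀pos : (0 : ℝ) < D₀ := by exact_mod_cast hD₀1
  have hD₁pos : (0 : ℝ) < D₁ := by exact_mod_cast hD₁1
  have hPbpos : (0 : ℝ) < Pb := by exact_mod_cast hPb1
  have hLrpos : 0 < Lr := by positivity
  have hLiou : ((3 * T).factorial : ℝ) * Real.exp (-U) <
      ((|(G.den : ℝ)| ^ ee * Lr * G.M ^ ee) ^ G.h)⁻¹ := by
    have hden : 0 < |(G.den : ℝ)| := lt_of_lt_of_le one_pos G.one_le_abs_den
    have hM : 0 < G.M := lt_of_lt_of_le one_pos G.one_le_M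
    set Θ : ℝ := (|(G.den : ℝ)| ^ ee * Lr * G.M ^ ee) ^ G.h with hΘ
    have hΘpos : 0 < Θ := by positivity
    have hlogΘ : Real.log Θ = (G.h : ℝ) * (ee * Real.log |(G.den : ℝ)| + Real.log Lr +
        ee * Real.log G.M) := by
      rw [hΘ, Real.log_pow, Real.log_mul (by positivity) (by positivity),
        Real.log_mul (by positivity) hLrpos.ne', Real.log_pow, Real.log_pow]
    have hfacpos : (0 : ℝ) < (3 * T).factorial := by exact_mod_cast Nat.factorial_pos _
    have hUΘ : U = Real.log ((3 * T).factorial : ℝ) + Real.log Θ + 1 := by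
      rw [hUdef, hlogΘ]
    have : ((3 * T).factorial : ℝ) * Real.exp (-U) = Real.exp (-1) * Θ⁻¹ := by
      rw [hUΘ, show -(Real.log ((3 * T).factorial : ℝ) + Real.log Θ + 1) =
          -Real.log ((3 * T).factorial : ℝ) + -Real.log Θ + -1 by ring,
        Real.exp_add, Real.exp_add, Real.exp_neg, Real.exp_neg, Real.exp_log hfacpos,
        Real.exp_log hΘpos]
      field_simp
    rw [this]
    have he1 : Real.exp (-1) < 1 := Real.exp_lt_one_iff.mpr (by norm_num)
    calc Real.exp (-1) * Θ⁻¹ < 1 * Θ⁻¹ := mul_lt_mul_of_pos_right he1 (inv_pos.mpr hΘpos)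
      _ = Θ⁻¹ := one_mul _
  -- part III: the derivatives vanish
  have hSr : (1 : ℝ) ≤ S := by exact_mod_cast (show 1 ≤ S by omega)
  have hBr : (B : ℝ) + 1 = S := by exact_mod_cast hB1
  have hRpts : ∀ μ : Fin 3 → ℕ, (∀ kk, μ kk ≤ 3 * B) →
      ‖γ * ((μ 0 : ℂ) * y 0 + (μ 1 : ℂ) * y 1 + (μ 2 : ℂ))‖ ≤ R ∧ ‖(μ 2 : ℂ) * γ‖ + 1 ≤ R := by
    intro μ hμ
    have hn : ∀ kk, ‖((μ kk : ℕ) : ℂ)‖ ≤ 3 * S := fun kk => by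
      rw [Complex.norm_natCast]
      have : ((μ kk : ℕ) : ℝ) ≤ ((3 * B : ℕ) : ℝ) := by exact_mod_cast hμ kk
      push_cast at this
      linarith
    have hγn := norm_nonneg γ
    have hy0n := norm_nonneg (y 0)
    have hy1n := norm_nonneg (y 1)
    constructor
    · rw [norm_mul, hRdef]
      calc ‖γ‖ * ‖(μ 0 : ℂ) * y 0 + (μ 1 : ℂ) * y 1 + (μ 2 : ℂ)‖
          ≤ ‖γ‖ * (3 * S * ‖y 0‖ + 3 * S * ‖y 1‖ + 3 * S) := by
            refine mul_le_mul_of_nonneg_left ?_ hγn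
            calc ‖(μ 0 : ℂ) * y 0 + (μ 1 : ℂ) * y 1 + (μ 2 : ℂ)‖
                ≤ ‖(μ 0 : ℂ) * y 0‖ + ‖(μ 1 : ℂ) * y 1‖ + ‖((μ 2 : ℕ) : ℂ)‖ := norm_add₃_le
              _ ≤ 3 * S * ‖y 0‖ + 3 * S * ‖y 1‖ + 3 * S := by
                  rw [norm_mul, norm_mul]
                  gcongr
                  · exact hn 0
                  · exact hn 1
                  · exact hn 2
        _ = (3 * ‖γ‖ * (‖y 0‖ + ‖y 1‖ + 1)) * S := by ring
        _ ≤ cR * S := by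
            refine mul_le_mul_of_nonneg_right ?_ (by linarith)
            rw [hcR]; linarith
    · rw [norm_mul, hRdef]
      calc ‖((μ 2 : ℕ) : ℂ)‖ * ‖γ‖ + 1 ≤ 3 * S * ‖γ‖ + 1 := by gcongr; exact hn 2
        _ ≤ cR * S := by
            rw [hcR]
            have : 0 ≤ 3 * ‖γ‖ * (‖y 0‖ + ‖y 1‖) * S := by positivity
            nlinarith
  have hvan := derivs_eq_zero G i₀ i₁ i₂ i₃ i₄ i₅ hγ0 hG0 hG1 hG2 hG3 hG4 hG5 hD₀1 hD₁1 hPb1 p hpP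
    hRpts hF (lt_of_le_of_lt (mul_le_mul_of_nonneg_left hE (by positivity)) hLiou)
  -- part I: the zero estimate
  obtain ⟨hdeg0, hdeg12⟩ := degreeOf_auxP p
  exact hc γ lam y hγl hy1 B T D₀ D₁ hD₀1 hD₁1 i1 i2 i3 i4 i5 i6 _ (auxP_ne_zero p hp0)
    (hdeg0.trans (Nat.sub_le _ _)) (fun h => (hdeg12 h).trans (Nat.sub_le _ _)) hvan

end Waldschmidt1988

/-! ### The discharge -/

open Waldschmidt1988 in
/-- **Five exponentials theorem** (Waldschmidt 1988, §2 c) Corollary 2.2), discharging the named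
fact `waldschmidt1988_fiveExponentials`: if `x₁, x₂` are `ℚ`-linearly independent, `y₁, y₂` are
`ℚ`-linearly independent and `η ≠ 0` is algebraic, then one of
`e^{x₁y₁}, e^{x₁y₂}, e^{x₂y₁}, e^{x₂y₂}, e^{ηx₂/x₁}` is transcendental. Proof: normalise to
`γ = η`, `λ = ηx₂/x₁`, `y_j ← x₁y_j/η` and apply `Waldschmidt1988.five_exp_core`; the independence
`ay₀ + by₁ + e = 0 ⇒ a = b = e = 0` comes from Hermite–Lindemann (`transcendental_exp_holds`).
[cite: Waldschmidt1988, §2 c) Corollary 2.2 (p. 378)] -/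
theorem waldschmidt1988_fiveExponentials_holds : waldschmidt1988_fiveExponentials := by
  intro x y hx hy η hηalg hη0
  classical
  by_contra hcon
  push Not at hcon
  obtain ⟨hall, h5⟩ := hcon
  simp only [Transcendental, not_not] at hall h5
  have hx0 : x 0 ≠ 0 := hx.ne_zero 0
  -- the normalised data `γ = η`, `λ = ηx₁/x₀`, `y'_j = x₀y_j/η`
  obtain ⟨lam, hlam⟩ : ∃ lam : ℂ, lam = η * x 1 / x 0 := ⟨_, rfl⟩
  obtain ⟨y', hy'⟩ : ∃ y' : Fin 2 → ℂ, y' = fun j => x 0 * y j / η := ⟨_, rfl⟩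
  have hγy : ∀ j, η * y' j = x 0 * y j := fun j => by
    rw [hy']; field_simp
  have hly : ∀ j, lam * y' j = x 1 * y j := fun j => by
    rw [hy', hlam]; field_simp
  have hβ : ∀ j, IsAlgebraic ℚ (cexp (η * y' j)) := fun j => by rw [hγy]; exact hall 0 j
  have hα : ∀ j, IsAlgebraic ℚ (cexp (lam * y' j)) := fun j => by rw [hly]; exact hall 1 j
  have hαl : IsAlgebraic ℚ (cexp lam) := by rw [hlam]; exact h5
  -- independence of `γ, λ` from that of `x₀, x₁`
  have hγl : ∀ a b : ℤ, (a : ℂ) * η + b * lam = 0 → a = 0 ∧ b = 0 := by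
    intro a b hab
    have hrel : (a : ℂ) * x 0 + b * x 1 = 0 := by
      rw [hlam] at hab
      field_simp at hab
      have : η * ((a : ℂ) * x 0 + b * x 1) = 0 := by linear_combination hab
      exact (mul_eq_zero.mp this).resolve_left hη0
    have key := Fintype.linearIndependent_iff.mp hx ![(a : ℚ), (b : ℚ)] (by
      rw [Fin.sum_univ_two]
      simp only [Matrix.cons_val_zero, Matrix.cons_val_one, Matrix.cons_val_fin_one]
      rw [Rat.smul_def, Rat.smul_def]
      push_cast
      exact hrel)
    have h0 := key 0
    have h1 := key 1
    simp only [Matrix.cons_val_zero, Matrix.cons_val_one, Matrix.cons_val_fin_one] at h0 h1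
    exact ⟨by exact_mod_cast h0, by exact_mod_cast h1⟩
  -- independence of `1, y'₀, y'₁` from that of `y₀, y₁` and Hermite–Lindemann
  have hy1 : ∀ a b e : ℤ, (a : ℂ) * y' 0 + b * y' 1 + e = 0 → a = 0 ∧ b = 0 ∧ e = 0 := by
    intro a b e habe
    by_cases he : e = 0
    · have hrel : (a : ℂ) * y 0 + b * y 1 = 0 := by
        rw [he, hy'] at habe
        simp only [Int.cast_zero, add_zero] at habe
        field_simp at habe
        have : (x 0) * ((a : ℂ) * y 0 + b * y 1) = 0 := by linear_combination habe
        exact (mul_eq_zero.mp this).resolve_left hx0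
      have key := Fintype.linearIndependent_iff.mp hy ![(a : ℚ), (b : ℚ)] (by
        rw [Fin.sum_univ_two]
        simp only [Matrix.cons_val_zero, Matrix.cons_val_one, Matrix.cons_val_fin_one]
        rw [Rat.smul_def, Rat.smul_def]
        push_cast
        exact hrel)
      have h0 := key 0
      have h1 := key 1
      simp only [Matrix.cons_val_zero, Matrix.cons_val_one, Matrix.cons_val_fin_one] at h0 h1
      exact ⟨by exact_mod_cast h0, by exact_mod_cast h1, he⟩
    · exfalso
      -- `e^{-eη} = (e^{γy'₀})^a (e^{γy'₁})^b` would be algebraic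
      have hexp : cexp (-(e : ℂ) * η) = cexp (η * y' 0) ^ a * cexp (η * y' 1) ^ b := by
        rw [← Complex.exp_int_mul, ← Complex.exp_int_mul, ← Complex.exp_add]
        congr 1
        linear_combination (-(η : ℂ)) * habe
      have halg : IsAlgebraic ℚ (cexp (-(e : ℂ) * η)) := by
        rw [hexp]
        have h0 : cexp (η * y' 0) ∈ algebraicClosure ℚ ℂ := mem_algebraicClosure_iff.mpr (hβ 0)
        have h1 : cexp (η * y' 1) ∈ algebraicClosure ℚ ℂ := mem_algebraicClosure_iff.mpr (hβ 1)
        exact mem_algebraicClosure_iff.mp (mul_mem (zpow_mem h0 a) (zpow_mem h1 b))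
      have htr : Transcendental ℚ (cexp (-(e : ℂ) * η)) := by
        refine transcendental_exp_holds ?_ ?_
        · exact (isAlgebraic_int e).neg.mul hηalg
        · exact mul_ne_zero (neg_ne_zero.mpr (by exact_mod_cast he)) hη0
      exact htr halg
  exact five_exp_core η lam y' hηalg hγl hy1 hβ hα hαl

end Literature.NumberTheory.Transcendental
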